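import Literature.NumberTheory.Rogawski1990.StableConjugacyU3
import HarnessLib

/-!
# The invariant of a conjugacy class inside a stable class of `U(H)`: the transported hermitian form `ᵗ(σg) H g`
# (Rogawski 1990, §3.1 p. 19 «`𝔇(I∕F)` parametrizes the conjugacy classes within the stable conjugacy class of `γ`»;
# §3.5 Prop. 3.5.2 p. 29: for a torus `T` of `U(3)`, `H¹(F, T) ≅ L^×∕N_{L′∕L}(L′^×)` = classes of hermitian forms on the `L′`-line)

Topic `NumberTheory/Rogawski1990`; namespace `Literature.NumberTheory.Rogawski1990`.  TWO definitions with bodies (`twistGram`, the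
Gram matrix of `H` transported by a matrix; `cartanTwist`, the same for a CHOSEN stable conjugator) and proved theorems; no instance, no
notation, no named fact, no `sorry`.  Cell `pub/hodgecm-mathlib`, ENGINE T1 (crux item stmt-HodgeConjecture-24833), F0P3a GO #96 (2) row
G6∕R1 «pre-stabilisation for the U(3) tori»: the COHOMOLOGY-FREE model of the invariant `inv(γ, δ) ∈ 𝔇(γ)` of ★ `StableClassInvariant`
(`invU`, non-abelian `H¹`), valid over ANY commutative ring `R` with a ring endomorphism `σ` and ANY matrix `H` — so that it transports
verbatim to `R = L` (rational), `R = L ⊗ L⁺_v` (local), `R = 𝔸_L` (adelic) and `R = L ⊗ ℝ` (archimedean) along ring maps commuting with `σ`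
(§4) — the input of R3∕R4 (Hasse, exactness: A-p14, A-p10), R5 (local index: A-p04) and R6∕R7 (`obs`, `ObsHasse`: B-p12, this seat).

THE MATHEMATICS.  `U(H)(R) = {g ∈ GL_n(R) : ᵗ(σg) H g = H}` (★ `unitaryGroup σ H`); `γ, δ ∈ U(H)(R)` are STABLY conjugate iff `δ = g γ g⁻¹`
for some `g ∈ GL_n(R)` (★ `IsStablyConj`, ★ `isStablyConj_iff`).  For such a `g` put `H_g := ᵗ(σg) H g` (`twistGram σ H g`).  Then
(§2) `γ` preserves BOTH `H` and `H_g` (`δ` preserves `H`, and `g` carries `(H, δ)`-invariance to `(H_g, γ)`-invariance), `H_g` is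
σ-hermitian when `H` is and `σ` is an involution, and `H⁻¹ H_g` commutes with `γ` (when `H` is invertible) — this is A-p10's `x = H⁻¹ ᵗ(σg) H g
∈ Z(γ)` and the census's `c`; the conjugators `g` of a given pair are `g t`, `t ∈ Z_{GL_n(R)}(γ)`, with `H_{gt} = ᵗ(σt) H_g t`, and `u g`,
`u ∈ U(H)(R)`, with `H_{ug} = H_g`; and (§3) **`δ` is `U(H)(R)`-conjugate to `γ` iff `H_g` is `Z(γ)`-EQUIVALENT to `H`**:
`(∃ u ∈ U(H)(R), u γ u⁻¹ = δ) ↔ ∃ t ∈ GL_n(R), t γ = γ t ∧ ᵗ(σt) H_g t = H`.  For `γ` regular semisimple over a field, `Z(γ) = (K ⊗ E)ˣ` for the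
étale algebra `K = L[γ]^{⋆}` and the `Z(γ)`-classes of `γ`-invariant hermitian forms are `Kˣ ∕ N((KE)ˣ)` = Rogawski's `H¹(F, T_γ)` (R2, R6).

* §1 `twistGram σ H g := ᵗ(σg) H g`: `twistGram_one`, `twistGram_mul`, `twistGram_coe_eq_of_mem_unitaryGroup`, `twistGram_unitary_mul`,
  `conjTranspose_twistGram` (hermitian), `twistGram_map` (functoriality along `f` with `f ∘ σ = σ′ ∘ f`).
* §2 for `g γ g⁻¹ = δ` in `GL_n(R)` with `γ, δ ∈ U(H)(R)`: `twistGram_invariant` (`ᵗ(σγ) H_g γ = H_g`), `commute_inv_mul_twistGram`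
  (`H⁻¹ H_g ∈ Z(γ)`, `IsUnit H.det`), `exists_commute_eq_mul_of_conj_eq` (conjugators differ by `Z(γ)`), `twistGram_eq_of_unitary_conj`.
* §3 **`exists_unitary_conj_iff_exists_commute_twistGram_eq`** (the criterion) and its expanded form `exists_unitary_conj_iff_exists_commute_congr_eq`.
* §4 `cartanTwist (h : IsStablyConj σ H γ δ)` — `H_g` for a CHOSEN stable conjugator: `cartanTwist_invariant`, `exists_unitary_conj_iff_cartanTwist`
  («`δ ∼ γ` in `U(H)(R)` iff `cartanTwist h` is `Z(γ)`-equivalent to `H`»), `exists_commute_twistGram_eq_congr_cartanTwist` (every stable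
  conjugator's `H_g` is `Z(γ)`-equivalent to `cartanTwist h`: a class function), `exists_commute_eq_congr_cartanTwist_refl` (at `δ = γ` the class is that of `H`),
  `conjTranspose_cartanTwist`, `commute_inv_mul_cartanTwist`.
HC_CM is proved only modulo the printed citations until rung 0 closes; this file is unconditional matrix algebra.

## References
* [Rogawski1990] J. D. Rogawski, *Automorphic Representations of Unitary Groups in Three Variables*, Ann. of Math. Stud. 123 (1990), §3.1
  p. 19 (the invariant `inv(γ, δ)` and `𝔇(I∕F)`), §3.5 Prop. 3.5.2 p. 29 (`H¹(F,T) ≅ L^×∕N(L′^×)`), §3.6 p. 31 (Cartan subgroups of `U(3)`).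
* [Kottwitz1986] R. E. Kottwitz, *Stable trace formula: elliptic singular terms*, Math. Ann. 275 (1986), §7, §9.
-/

set_option autoImplicit false

noncomputable section

namespace Literature.NumberTheory.Rogawski1990

open scoped MatrixGroups Matrix
open Literature.AlgebraicGeometry.ShimuraVarieties (unitaryGroup mem_unitaryGroup_iff)

section General

variable {R : Type*} [CommRing R] {n : Type*} [Fintype n] (σ : R →+* R) (H : Matrix n n R)

/-! ## §1 The transported Gram matrix `H_g = ᵗ(σg) H g` -/

/-- **`H_g := ᵗ(σg) H g`** — the Gram matrix of the form `H` transported by the matrix `g` (so that `U(H)(R) = {g : H_g = H}`).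
[cite: Rogawski1990, §3.1 p. 19] -/
def twistGram (g : Matrix n n R) : Matrix n n R :=
  (g.map σ)ᵀ * H * g

/-- Unfolding of `twistGram`. [cite: Rogawski1990, §3.1 p. 19] -/
theorem twistGram_def (g : Matrix n n R) : twistGram σ H g = (g.map σ)ᵀ * H * g := rfl

/-- **Transport is a right action**: `H_{g t} = ᵗ(σt) H_g t`. [cite: Rogawski1990, §3.1 p. 19] -/
theorem twistGram_mul (g t : Matrix n n R) : twistGram σ H (g * t) = (t.map σ)ᵀ * twistGram σ H g * t := by
  simp only [twistGram_def, Matrix.map_mul, Matrix.transpose_mul, Matrix.mul_assoc]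

/-- **`H_g` is σ-hermitian when `H` is and `σ` is an involution**: `ᵗ(σ H_g) = H_g`. [cite: Rogawski1990, §3.5 p. 29] -/
theorem conjTranspose_twistGram (hσ : ∀ r : R, σ (σ r) = r) (hH : (H.map σ)ᵀ = H) (g : Matrix n n R) :
    ((twistGram σ H g).map σ)ᵀ = twistGram σ H g := by
  have hgg : (g.map σ).map σ = g := by
    ext i j
    simp only [Matrix.map_apply, hσ]
  have h1 : ((g.map σ)ᵀ.map σ)ᵀ = g := by rw [Matrix.transpose_map, hgg, Matrix.transpose_transpose]
  rw [twistGram_def, Matrix.map_mul, Matrix.map_mul, Matrix.transpose_mul, Matrix.transpose_mul, h1, hH, Matrix.mul_assoc]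

/-- **Functoriality**: along a ring map `f : R → R′` intertwining `σ` and `σ′`, `f(H_g) = (fH)_{fg}` — the invariant is transported by every
change of coefficients commuting with the involutions (`L → L ⊗ L⁺_v`, `L → 𝔸_L`, `L → L ⊗ ℝ`). [cite: Rogawski1990, §3.3 p. 21] -/
theorem twistGram_map {R' : Type*} [CommRing R'] (σ' : R' →+* R') (f : R →+* R') (hf : ∀ r : R, f (σ r) = σ' (f r))
    (g : Matrix n n R) : (twistGram σ H g).map f = twistGram σ' (H.map f) (g.map f) := by
  have hcomp : (g.map σ).map f = (g.map f).map σ' := by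
    ext i j
    simp only [Matrix.map_apply, hf]
  rw [twistGram_def, twistGram_def, Matrix.map_mul, Matrix.map_mul, Matrix.transpose_map, hcomp]

variable [DecidableEq n]

/-- `H_1 = H`. [cite: Rogawski1990, §3.1 p. 19] -/
@[simp] theorem twistGram_one : twistGram σ H 1 = H := by
  rw [twistGram_def, Matrix.map_one σ (map_zero σ) (map_one σ), Matrix.transpose_one, Matrix.one_mul, Matrix.mul_one]

/-- A unitary matrix does not move `H`: `H_u = H` for `u ∈ U(H)(R)`. [cite: Rogawski1990, §3.1 p. 19] -/
theorem twistGram_coe_eq_of_mem_unitaryGroup {u : GL n R} (hu : u ∈ unitaryGroup σ H) :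
    twistGram σ H (u : Matrix n n R) = H :=
  mem_unitaryGroup_iff.mp hu

/-- `H_g = H` iff `g ∈ U(H)(R)`, for invertible `g`. [cite: Rogawski1990, §3.1 p. 19] -/
theorem twistGram_coe_eq_iff_mem_unitaryGroup (g : GL n R) : twistGram σ H (g : Matrix n n R) = H ↔ g ∈ unitaryGroup σ H :=
  mem_unitaryGroup_iff.symm

/-- **Left unitary invariance**: `H_{u g} = H_g` for `u ∈ U(H)(R)`. [cite: Rogawski1990, §3.1 p. 19] -/
theorem twistGram_unitary_mul {u : GL n R} (hu : u ∈ unitaryGroup σ H) (g : Matrix n n R) :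
    twistGram σ H ((u : Matrix n n R) * g) = twistGram σ H g := by
  rw [twistGram_mul, twistGram_coe_eq_of_mem_unitaryGroup σ H hu, twistGram_def]

/-! ## §2 `H_g` for a stable conjugator `g` (`g γ g⁻¹ = δ` with `γ, δ ∈ U(H)(R)`) -/

/-- If `g γ g⁻¹ = δ` in `GL_n(R)` then `g γ = δ g` as matrices. [folklore] -/
private theorem coe_mul_eq_of_conj_eq {γ δ g : GL n R} (hg : g * γ * g⁻¹ = δ) :
    (g : Matrix n n R) * (γ : Matrix n n R) = (δ : Matrix n n R) * (g : Matrix n n R) := by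
  have h : g * γ = δ * g := by rw [← hg, inv_mul_cancel_right]
  simpa only [Units.val_mul] using congrArg (fun x : GL n R => (x : Matrix n n R)) h

/-- **`γ` preserves the transported form**: if `γ, δ ∈ U(H)(R)` and `g γ g⁻¹ = δ` then `ᵗ(σγ) H_g γ = H_g` (`H_{gγ} = H_{δg} = H_g` by left
unitary invariance).  With `ᵗ(σγ) H γ = H` this says: `γ` lies in the unitary group of BOTH forms `H` and `H_g`.
[cite: Rogawski1990, §3.1 p. 19] -/
theorem twistGram_invariant {γ δ : unitaryGroup σ H} {g : GL n R} (hg : g * (γ : GL n R) * g⁻¹ = δ) :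
    (((γ : GL n R) : Matrix n n R).map σ)ᵀ * twistGram σ H (g : Matrix n n R) * ((γ : GL n R) : Matrix n n R) =
      twistGram σ H (g : Matrix n n R) := by
  rw [← twistGram_mul, coe_mul_eq_of_conj_eq hg, twistGram_unitary_mul σ H δ.2]

/-- **Two stable conjugators differ by the centraliser**: if `g γ g⁻¹ = δ = g′ γ g′⁻¹` then `g′ = g t` with `t γ = γ t`.
[cite: Rogawski1990, §3.1 p. 19] -/
theorem exists_commute_eq_mul_of_conj_eq {γ δ g g' : GL n R} (hg : g * γ * g⁻¹ = δ) (hg' : g' * γ * g'⁻¹ = δ) :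
    ∃ t : GL n R, t * γ = γ * t ∧ g' = g * t := by
  refine ⟨g⁻¹ * g', ?_, by rw [mul_inv_cancel_left]⟩
  have h1 : g * γ = δ * g := by rw [← hg, inv_mul_cancel_right]
  have h2 : g' * γ = δ * g' := by rw [← hg', inv_mul_cancel_right]
  have hγ : γ = g⁻¹ * δ * g := by rw [mul_assoc, ← h1, inv_mul_cancel_left]
  calc g⁻¹ * g' * γ = g⁻¹ * (δ * g') := by rw [mul_assoc, h2]
    _ = (g⁻¹ * δ * g) * (g⁻¹ * g') := by simp only [mul_assoc, mul_inv_cancel_left]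
    _ = γ * (g⁻¹ * g') := by rw [← hγ]

/-- **`H_g` depends only on the `U(H)(R)`-class of `δ`**: if `g γ g⁻¹ = δ` and `u ∈ U(H)(R)` then `u g` conjugates `γ` to `u δ u⁻¹` and
`H_{ug} = H_g`. [cite: Rogawski1990, §3.1 p. 19] -/
theorem twistGram_eq_of_unitary_conj {γ δ : GL n R} {g u : GL n R} (hu : u ∈ unitaryGroup σ H) (hg : g * γ * g⁻¹ = δ) :
    (u * g) * γ * (u * g)⁻¹ = u * δ * u⁻¹ ∧
      twistGram σ H ((u * g : GL n R) : Matrix n n R) = twistGram σ H (g : Matrix n n R) := by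
  refine ⟨by rw [mul_inv_rev, ← hg]; simp only [mul_assoc], ?_⟩
  rw [Units.val_mul, twistGram_unitary_mul σ H hu]

/-- **`H⁻¹ H_g` commutes with `γ`** (for `H` invertible): from `ᵗ(σγ) H γ = H` and `ᵗ(σγ) H_g γ = H_g`.  This is the element `x = H⁻¹ ᵗ(σg) H g`
of the centraliser `Z(γ)` — for `γ` regular, of the commutative algebra `L[γ] = K ⊗ E` — whose class modulo norms is Rogawski's `inv(γ, δ)`.
[cite: Rogawski1990, §3.1 p. 19; §3.5 p. 29] -/
theorem commute_inv_mul_twistGram (hH : IsUnit H.det) {γ δ : unitaryGroup σ H} {g : GL n R} (hg : g * (γ : GL n R) * g⁻¹ = δ) :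
    Commute (H⁻¹ * twistGram σ H (g : Matrix n n R)) ((γ : GL n R) : Matrix n n R) := by
  set T := twistGram σ H (g : Matrix n n R) with hT
  set c : Matrix n n R := ((γ : GL n R) : Matrix n n R) with hc
  have hγ : (c.map σ)ᵀ * H * c = H := mem_unitaryGroup_iff.mp γ.2
  have hTγ : (c.map σ)ᵀ * T * c = T := twistGram_invariant σ H hg
  -- `γ` is invertible with inverse `γ⁻¹`
  have hcinv : c * (((γ : GL n R)⁻¹ : GL n R) : Matrix n n R) = 1 := by
    rw [hc, ← Units.val_mul, mul_inv_cancel, Units.val_one]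
  have hcinv' : (((γ : GL n R)⁻¹ : GL n R) : Matrix n n R) * c = 1 := by
    rw [hc, ← Units.val_mul, inv_mul_cancel, Units.val_one]
  -- from `ᵗ(σγ) H γ = H`: `ᵗ(σγ) = H γ⁻¹ H⁻¹`
  have hHinv : H * H⁻¹ = 1 := Matrix.mul_nonsing_inv H hH
  have hHinv' : H⁻¹ * H = 1 := Matrix.nonsing_inv_mul H hH
  have hσγ : (c.map σ)ᵀ = H * (((γ : GL n R)⁻¹ : GL n R) : Matrix n n R) * H⁻¹ := by
    calc (c.map σ)ᵀ = (c.map σ)ᵀ * H * c * ((((γ : GL n R)⁻¹ : GL n R) : Matrix n n R) * H⁻¹) := by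
          rw [Matrix.mul_assoc ((c.map σ)ᵀ * H), ← Matrix.mul_assoc c, hcinv, Matrix.one_mul, Matrix.mul_assoc, hHinv,
            Matrix.mul_one]
      _ = H * (((γ : GL n R)⁻¹ : GL n R) : Matrix n n R) * H⁻¹ := by rw [hγ, Matrix.mul_assoc]
  -- hence `T = H γ⁻¹ H⁻¹ T γ`, i.e. `H⁻¹ T γ = γ⁻¹… `: multiply out
  have key : H⁻¹ * T = (((γ : GL n R)⁻¹ : GL n R) : Matrix n n R) * (H⁻¹ * T) * c := by
    calc H⁻¹ * T = H⁻¹ * ((c.map σ)ᵀ * T * c) := by rw [hTγ]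
      _ = H⁻¹ * (H * (((γ : GL n R)⁻¹ : GL n R) : Matrix n n R) * H⁻¹ * T * c) := by rw [hσγ]
      _ = (H⁻¹ * H) * (((γ : GL n R)⁻¹ : GL n R) : Matrix n n R) * H⁻¹ * T * c := by simp only [Matrix.mul_assoc]
      _ = (((γ : GL n R)⁻¹ : GL n R) : Matrix n n R) * (H⁻¹ * T) * c := by rw [hHinv', Matrix.one_mul]; simp only [Matrix.mul_assoc]
  -- `Commute (H⁻¹ T) γ`: `H⁻¹ T γ = γ (γ⁻¹ H⁻¹ T γ) = γ H⁻¹ T`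
  show H⁻¹ * T * c = c * (H⁻¹ * T)
  conv_rhs => rw [key]
  rw [← Matrix.mul_assoc, ← Matrix.mul_assoc, hcinv, Matrix.one_mul]

/-! ## §3 The criterion: `δ ∼_{U(H)(R)} γ` iff `H_g` is `Z(γ)`-equivalent to `H` -/

/-- **`δ` is `U(H)(R)`-conjugate to `γ` iff the transported form `H_g` is equivalent to `H` by a matrix commuting with `γ`**:
for `g γ g⁻¹ = δ` in `GL_n(R)`, `(∃ u ∈ U(H)(R), u γ u⁻¹ = δ) ↔ ∃ t ∈ GL_n(R), t γ = γ t ∧ H_{g t} = H` (and `H_{gt} = ᵗ(σt) H_g t`,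
`twistGram_mul`).  (→): `u = g t` with `t = g⁻¹u ∈ Z(γ)`; (←): `u := g t` is unitary and conjugates `γ` to `δ`.  This is «`inv(γ, δ) = 1 ⟺
δ ∼ γ`» of [Rogawski1990, §3.1] in form language. [cite: Rogawski1990, §3.1 p. 19] [cite: Kottwitz1986, §7] -/
theorem exists_unitary_conj_iff_exists_commute_twistGram_eq {γ δ g : GL n R} (hg : g * γ * g⁻¹ = δ) :
    (∃ u : GL n R, u ∈ unitaryGroup σ H ∧ u * γ * u⁻¹ = δ) ↔
      ∃ t : GL n R, t * γ = γ * t ∧ twistGram σ H ((g * t : GL n R) : Matrix n n R) = H := by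
  constructor
  · rintro ⟨u, hu, huγ⟩
    obtain ⟨t, ht, rfl⟩ := exists_commute_eq_mul_of_conj_eq hg huγ
    exact ⟨t, ht, twistGram_coe_eq_of_mem_unitaryGroup σ H hu⟩
  · rintro ⟨t, ht, hHt⟩
    refine ⟨g * t, (twistGram_coe_eq_iff_mem_unitaryGroup σ H (g * t)).mp hHt, ?_⟩
    rw [mul_inv_rev, show g * t * γ * (t⁻¹ * g⁻¹) = g * (t * γ * t⁻¹) * g⁻¹ by simp only [mul_assoc], ht,
      mul_inv_cancel_right, hg]

/-- The same criterion with `H_{g t}` expanded: `∃ t ∈ Z_{GL_n(R)}(γ)` with `ᵗ(σt) H_g t = H`. [cite: Rogawski1990, §3.1 p. 19] -/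
theorem exists_unitary_conj_iff_exists_commute_congr_eq {γ δ g : GL n R} (hg : g * γ * g⁻¹ = δ) :
    (∃ u : GL n R, u ∈ unitaryGroup σ H ∧ u * γ * u⁻¹ = δ) ↔
      ∃ t : GL n R, t * γ = γ * t ∧ ((t : Matrix n n R).map σ)ᵀ * twistGram σ H (g : Matrix n n R) * (t : Matrix n n R) = H := by
  rw [exists_unitary_conj_iff_exists_commute_twistGram_eq σ H hg]
  simp only [Units.val_mul, twistGram_mul]

/-! ## §4 `cartanTwist`: the transported form for a CHOSEN stable conjugator (a class function up to `Z(γ)`-equivalence) -/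

/-- **`cartanTwist h`** — for stably conjugate `γ, δ ∈ U(H)(R)`, the form `H` transported by a chosen `g ∈ GL_n(R)` with `g γ g⁻¹ = δ`; its class up
to `Z(γ)`-equivalence is the invariant `inv(γ, δ) ∈ 𝔇(γ)` of [Rogawski1990, §3.1] in form language (well defined by
`exists_commute_eq_mul_of_conj_eq` ∕ `twistGram_mul`). [cite: Rogawski1990, §3.1 p. 19] -/
def cartanTwist {γ δ : unitaryGroup σ H} (h : IsStablyConj σ H γ δ) : Matrix n n R :=
  twistGram σ H ((Classical.choose (isStablyConj_iff.mp h) : GL n R) : Matrix n n R)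

/-- The chosen conjugator conjugates. [cite: Rogawski1990, §3.1 p. 19] -/
theorem choose_conj_eq {γ δ : unitaryGroup σ H} (h : IsStablyConj σ H γ δ) :
    Classical.choose (isStablyConj_iff.mp h) * (γ : GL n R) * (Classical.choose (isStablyConj_iff.mp h))⁻¹ = δ :=
  Classical.choose_spec (isStablyConj_iff.mp h)

/-- Unfolding of `cartanTwist`. [cite: Rogawski1990, §3.1 p. 19] -/
theorem cartanTwist_def {γ δ : unitaryGroup σ H} (h : IsStablyConj σ H γ δ) :
    cartanTwist σ H h = twistGram σ H ((Classical.choose (isStablyConj_iff.mp h) : GL n R) : Matrix n n R) := rfl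

/-- **`γ` preserves `cartanTwist h`.** [cite: Rogawski1990, §3.1 p. 19] -/
theorem cartanTwist_invariant {γ δ : unitaryGroup σ H} (h : IsStablyConj σ H γ δ) :
    (((γ : GL n R) : Matrix n n R).map σ)ᵀ * cartanTwist σ H h * ((γ : GL n R) : Matrix n n R) = cartanTwist σ H h :=
  twistGram_invariant σ H (choose_conj_eq σ H h)

/-- `cartanTwist h` is σ-hermitian when `H` is and `σ` is an involution. [cite: Rogawski1990, §3.5 p. 29] -/
theorem conjTranspose_cartanTwist (hσ : ∀ r : R, σ (σ r) = r) (hH : (H.map σ)ᵀ = H) {γ δ : unitaryGroup σ H}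
    (h : IsStablyConj σ H γ δ) : ((cartanTwist σ H h).map σ)ᵀ = cartanTwist σ H h :=
  conjTranspose_twistGram σ H hσ hH _

/-- `H⁻¹ · cartanTwist h` commutes with `γ` (for `H` invertible). [cite: Rogawski1990, §3.1 p. 19] -/
theorem commute_inv_mul_cartanTwist (hH : IsUnit H.det) {γ δ : unitaryGroup σ H} (h : IsStablyConj σ H γ δ) :
    Commute (H⁻¹ * cartanTwist σ H h) ((γ : GL n R) : Matrix n n R) :=
  commute_inv_mul_twistGram σ H hH (choose_conj_eq σ H h)

/-- **THE CRITERION for `cartanTwist`**: stably conjugate `γ, δ ∈ U(H)(R)` are `U(H)(R)`-conjugate iff `cartanTwist h` is `Z(γ)`-equivalent to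
`H`: `(∃ u ∈ U(H)(R), u γ u⁻¹ = δ) ↔ ∃ t ∈ GL_n(R), t γ = γ t ∧ ᵗ(σt) · cartanTwist h · t = H`. [cite: Rogawski1990, §3.1 p. 19] [cite: Kottwitz1986, §7] -/
theorem exists_unitary_conj_iff_cartanTwist {γ δ : unitaryGroup σ H} (h : IsStablyConj σ H γ δ) :
    (∃ u : GL n R, u ∈ unitaryGroup σ H ∧ u * (γ : GL n R) * u⁻¹ = δ) ↔
      ∃ t : GL n R, t * (γ : GL n R) = γ * t ∧ ((t : Matrix n n R).map σ)ᵀ * cartanTwist σ H h * (t : Matrix n n R) = H :=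
  exists_unitary_conj_iff_exists_commute_congr_eq σ H (choose_conj_eq σ H h)

/-- **`cartanTwist` is a class function of `δ` up to `Z(γ)`-equivalence**: for ANY stable conjugator `g` of `(γ, δ)` there is `t ∈ Z_{GL_n(R)}(γ)`
with `H_g = ᵗ(σt) · cartanTwist h · t`; in particular two choices, or `δ` replaced by a `U(H)(R)`-conjugate (`twistGram_eq_of_unitary_conj`),
give `Z(γ)`-equivalent forms. [cite: Rogawski1990, §3.1 p. 19] -/
theorem exists_commute_twistGram_eq_congr_cartanTwist {γ δ : unitaryGroup σ H} (h : IsStablyConj σ H γ δ) {g : GL n R}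
    (hg : g * (γ : GL n R) * g⁻¹ = δ) :
    ∃ t : GL n R, t * (γ : GL n R) = γ * t ∧
      twistGram σ H (g : Matrix n n R) = ((t : Matrix n n R).map σ)ᵀ * cartanTwist σ H h * (t : Matrix n n R) := by
  obtain ⟨t, ht, rfl⟩ := exists_commute_eq_mul_of_conj_eq (choose_conj_eq σ H h) hg
  exact ⟨t, ht, by rw [Units.val_mul, twistGram_mul, cartanTwist_def]⟩

/-- At `δ = γ` the class of `cartanTwist` is that of `H` itself: `H = ᵗ(σt) · cartanTwist (refl) · t` for some `t ∈ Z(γ)` (take `g = 1`).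
[cite: Rogawski1990, §3.1 p. 19] -/
theorem exists_commute_eq_congr_cartanTwist_refl (γ : unitaryGroup σ H) :
    ∃ t : GL n R, t * (γ : GL n R) = γ * t ∧
      H = ((t : Matrix n n R).map σ)ᵀ * cartanTwist σ H (IsStablyConj.refl γ) * (t : Matrix n n R) := by
  have h1 : (1 : GL n R) * (γ : GL n R) * 1⁻¹ = γ := by rw [one_mul, inv_one, mul_one]
  obtain ⟨t, ht, h⟩ := exists_commute_twistGram_eq_congr_cartanTwist σ H (IsStablyConj.refl γ) h1
  exact ⟨t, ht, by rwa [Units.val_one, twistGram_one] at h⟩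

end General

end Literature.NumberTheory.Rogawski1990

end
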